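import Summits.QuantumFields.YangMills.Theorems.BalabanUVNodesN11Thm2OfRecordKeyed
import Summits.QuantumFields.YangMills.Theorems.BalabanUVNodesN11Thm2BSideOfLawsRTAtRecord13CoPH
import Summits.QuantumFields.YangMills.Theorems.BalabanUVNodesN11Sect3SupplyChainObligationsDefs

/-!
# DAG node N11 — [III] THEOREM 2 ∕ (2.49) ALONG THE WITNESS CHAIN: the keyed carrier AT dag-n11-e's chain witness `(chainWitness θ p σ k).1`, the 𝐁-side (2.48) DISCHARGED
# from the chain's inductive hypothesis `ChainFormAt θ p σ k` (its `LawsRT` ⊇ (2.42)) + the (2.41)(ii) membership of the configuration, and (2.49) for the chain's effective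
# action at every regular configuration from `B14.Thm2Printed` (keyed) — or, on the live-selector line, from `SupplierObligations ∧ NoExpansionObligation` + `Thm2Printed`

Cell `pub-ymgap`, YM-PLAN Track A (HUMAN RULING D-0062 ∕ D-0149), seat `pub-ymgap-dag-n11-w2` (g2), route `BalabanUVNodes`, key item K1⁷ `StabilityBAtRecordR13SepCoPH` =
stmt-QuantumFields-20542 (helper, count-neutral).  [III] = [Balaban1988Convergent].  Junction of g2's `…Thm2OfRecordKeyed` (keyed carrier: produce ∕ consume), g2's
`…Thm2BSideOfLawsRTAtRecord13CoPH` (`h248_of_lawsRT_of_mem_spaceMS`) and dag-n11-e g16's `…Sect3SupplyChainObligationsDefs` (p595576: `ChainFormAt`, `SupplierObligations`,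
`NoExpansionObligation`, `chainFormAt_all_of_obligations`; `chainWitness` of `…Sect3SupplyChainDefs` p591185) — CONSUMED BY NAME, nothing of theirs restated.

WHY THIS FILE.  Print's Theorem 2 is about «E^{(j)}, R^{(j)}» = THE terms §3 constructs; at NODE 00 those are dag-n11-e's chain witness `chainWitness θ p σ k` of a supplier `σ`
(the 𝐓-step SUPPLY).  g2's keyed carrier takes a witness family as a PARAMETER; THIS FILE instantiates it at the chain (`fun k s ↦ (chainWitness θ p σ k).1 s`) and closes the
𝐁-side: the chain's inductive hypothesis `ChainFormAt θ p σ k` carries def-T's `Sect2.LawsRT` for the chain witness at every history (§1), whence r11's (2.42) `LFHyp.boundB`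
and — by g2 FILE D + g0 FILE 12 — the (2.48) binder `h248` for every configuration whose pair `(ιU, 0)` lies in `Ũ^c_j(X)` of record (§2).  So (2.49) for the CHAIN's
(2.23)-action costs (§3): Theorem 2 keyed to the chain (the cell's `def … : Prop`, produced in `…Thm2OfRecordKeyed` §2 from §3's sentences), the chain's form at level `k`
(Theorem 1 along the chain: dag-n11-e's `chainFormAt_all_of_obligations` from `SupplierObligations ∧ NoExpansionObligation` on the live-selector line), the regularity class
`𝒰 ⊆ {(2.41)(ii)-regular}`, (2.46)'s `R₁`-smallness and the vacuum sentence — and NOTHING ELSE of the 𝐁-side.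

WHAT THIS FILE PROVES (0 `sorry`, 0 `def`, standard axioms; count-neutral; nothing of Bałaban's asserted).
§1 `lawsRT_chainWitness_of_chainFormAt` (`ChainFormAt θ p σ k` ⇒ `LawsRT` of the tower of record of `(s, (chainWitness θ p σ k).1 s)` at every history `s`) ·
   `lawsRT_chainWitness_of_obligations` (the same for all `k ≤ K` from `(hσ, hT)` + def-T's provisos on the live-selector line, via dag-n11-e's `chainFormAt_all_of_obligations`).
§2 ★ `h248_chainWitness_of_chainFormAt` ((2.48) binder for the chain witness at every `U` with `(ιU,0) ∈ Ũ^c_j(X)` on the (2.41)(i) range; constants of record `θ.s2.lf.B₀·K₀`,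
   volumes `≥ #ring_n(s)`).
§4 A6: `one_mem_spaceMS_rzAt` (the unit configuration lies in `Ũ^c_j(X)` of record at every history, positive radii displayed) · ★ `unitClass_regular` (the unit class meets
   §3's regularity hypothesis; with g2 FILE C's `thm2Printed_keyed_unitClass` the class hypotheses of §3 are jointly inhabited).
§3 ★★ `ineq249_action23_chainWitness_of_thm2Printed_keyed` (Theorem 2 keyed to the chain at a class `𝒰` of (2.41)(ii)-regular configurations + `0 < β < 1`, `1 < L`, `κ₀ ≥ 7`,
   `H033` at the run's flow, couplings `≥ 0`, `κ₀(4·2^d, 2d) ≤ θ.s2.lf.κ`, `0 ≤ θ.s2.lf.B₀`, `1 ≤ M` ⇒ `∃ E₁ R₁ ≥ 0` such that at every level `k ≤ K` WHERE THE CHAIN HAS THE FORM,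
   every history `s`, every `U ∈ 𝒰 k s`, volumes `Γ_n ≥ |Γ_n(s)| + #ring_n(s)`-wise (two displayed dominations), (2.46)'s `R₁`-smallness and the vacuum sentence give (2.49) for
   the chain's (2.23)-action with `O(1) = E₁(1−L^{−β})⁻¹ + 1 + 2·θ.s2.lf.B₀·K₀(4·2^d, 2d) + E₂`) · ★★★ `ineq249_action23_chainWitness_of_obligations` (the same at ALL `k ≤ K` on the
   live-selector line from `SupplierObligations θ p σ ∧ NoExpansionObligation θ p σ` + def-T's provisos — N11's one-token residual `SupplyChainAt` opened — + Theorem 2 keyed).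

HONEST FRAMING.  Kernel composition of landed files; Theorem 2 (keyed) is a HYPOTHESIS here (produced elsewhere from displayed §3 sentences), the supplier's obligations are
HYPOTHESES (nobody's theorem: [III] §3's construction), the regularity class is a PARAMETER with a displayed inclusion; nothing of Bałaban asserted; N11 NOT discharged; K1⁷ NOT
closed; counts unmoved (typed 28∕28 · discharged 5∕27).  One finite four-torus programme at fixed `ε = L^{−K}`; R4 closes only the conditional finite-𝕋⁴ rung `BalabanLadder.UV`;
NOT ℝ⁴, NOT OS, NOT the Yang–Mills mass gap (Clay), which none of this proves.
Sources: [III] Thm 1 p.262, Thm 2 p.263, (2.41)–(2.42) p.261, (2.45)–(2.49) pp.263–264, §3 p.279; [Balaban1988RG2Cluster] (1.26) p.8.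
-/

noncomputable section

open scoped BigOperators Matrix.Norms.L2Operator

namespace Summit.QuantumFields.YangMills.Theorems.BalabanUVNodesN11Thm2AlongSupplyChain

open Literature.MathematicalPhysics.QuantumFieldTheory.Balaban1983to89 Step B14.Eq225Concrete B14.LocalCoupling B14Thm2 B12TreeDecay TreeLengthTorus Finset
open T4Continuum Node00 B15DeterminingSets
open B10Eq38TorusDomains (toFine)
open BalabanUVNodesN11Sect3SupplyChainDefs (Sect3Supplier chainWitness)
open BalabanUVNodesN11Sect3SupplyChainObligationsDefs (ChainFormAt SupplierObligations NoExpansionObligation chainFormAt_all_of_obligations)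
open BalabanUVNodesN11Thm2Sect2DataOfRecordKeyedDefs (sect2DataOfRecord₁₃Keyed)
open BalabanUVNodesN11Thm2OfRecordKeyed (ineq249_action23_of_thm2Printed_keyed)
open BalabanUVNodesN11Thm2BSideOfLawsRTAtRecord13CoPH (h248_of_lawsRT_of_mem_spaceMS)

variable {F : T4Family} {N : ℕ} [NeZero N]
variable (θ : Stage13HParams F N) (p : B12.RunParams) (σ : Sect3Supplier θ p)

/-! ## §1. The chain's inductive hypothesis carries the laws of the chain witness -/

/-- **`ChainFormAt θ p σ k` ⇒ def-T's `Sect2.LawsRT` for the chain witness at every history** (the law clause of `HasSect2FormAtZS`). [cite: Balaban1988Convergent, Thm 1 p.262, (2.27)–(2.42) pp.259–261] -/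
theorem lawsRT_chainWitness_of_chainFormAt {k : ℕ} (h : ChainFormAt θ p σ k)
    (s : SeqOfRecord F θ.ν θ.τ9.M (gOfRecord₁₃ F N θ.toStage13Params p) p.K k) :
    Sect2.LawsRT (sect2TowerOfRecord F N (FluctV N) p.K (settingOfRecord₁₃ F N θ.toStage13Params p) (θ.rzAt p s) s ((chainWitness θ p σ k).1 s))
      (settingOfRecord₁₃ F N θ.toStage13Params p).lf k :=
  (h.2 s).1

/-- **… for all `k ≤ K` from the supplier's obligations on the live-selector line** (dag-n11-e's `chainFormAt_all_of_obligations`). [cite: Balaban1988Convergent, Thm 1 p.262, §3 p.279] -/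
theorem lawsRT_chainWitness_of_obligations (hprov : θ.Provisos₁₃CoPH F N)
    (hsel : θ.ppSel = ppSelLiveOfRecord F N θ.ν θ.τ9 (EOfRecord₁₃ F N θ.toStage13Params) (wOfRecord₉ F N θ.toStage9Params))
    (hθ : θ.Admissible F N) (hκ : 0 ≤ θ.s2.lf.κ) (hE₀ : 0 ≤ θ.s2.lf.E₀) (hB₀ : 0 ≤ θ.s2.lf.B₀) (hM : 1 ≤ θ.τ9.M)
    (hσ : SupplierObligations θ p σ) (hT : NoExpansionObligation θ p σ) {k : ℕ} (hk : k ≤ p.K)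
    (s : SeqOfRecord F θ.ν θ.τ9.M (gOfRecord₁₃ F N θ.toStage13Params p) p.K k) :
    Sect2.LawsRT (sect2TowerOfRecord F N (FluctV N) p.K (settingOfRecord₁₃ F N θ.toStage13Params p) (θ.rzAt p s) s ((chainWitness θ p σ k).1 s))
      (settingOfRecord₁₃ F N θ.toStage13Params p).lf k :=
  lawsRT_chainWitness_of_chainFormAt θ p σ (chainFormAt_all_of_obligations hprov hsel hθ hκ hE₀ hB₀ hM σ hσ hT k hk) s

/-! ## §2. The 𝐁-side (2.48) for the chain witness from the chain's form + the (2.41)(ii) membership -/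

open Classical in
/-- **★ (2.48) FOR THE CHAIN WITNESS** at a configuration whose pair `(ιU, 0)` lies in `Ũ^c_j(X)` of record on the (2.41)(i) range (`j = 1,…,k`): from `ChainFormAt θ p σ k` alone on
the witness side (constants of record `θ.s2.lf.B₀·K₀(4·2^d, 2d)`, volumes `Γ_n ≥ #ring_n(s)`; g2 FILE D ∘ g0 FILE 12). [cite: Balaban1988Convergent, (2.42) p.261, (2.47)–(2.48) pp.263–264] -/
theorem h248_chainWitness_of_chainFormAt {k : ℕ} (h : ChainFormAt θ p σ k)
    (s : SeqOfRecord F θ.ν θ.τ9.M (gOfRecord₁₃ F N θ.toStage13Params p) p.K k) (a : Tk.SFluct (F.P p.K) (FluctV N)) (U : GaugeField (F.P p.K) 0 (SU N))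
    (hk : k ≤ (F.P p.K).m + (F.P p.K).K) (hM : 1 ≤ θ.τ9.M) (hκ : kappa₀ (4 * 2 ^ (F.P p.K).d) (2 * (F.P p.K).d) ≤ θ.s2.lf.κ) (hB₀ : 0 ≤ θ.s2.lf.B₀)
    (hU : ∀ j, 1 ≤ j → j ≤ k → ∀ X, Sect2.admB (F.P p.K) θ.ν θ.τ9.M (gOfRecord₁₃ F N θ.toStage13Params p) s.Ω s.Λ j (Sect2.domSites (F.P p.K) θ.τ9.M j X) = true →
      Sect2.ofBackgroundC (ιSU N) U ∈ Sect2.spaceMS (settingOfRecord₁₃ F N θ.toStage13Params p) (θ.rzAt p s) θ.τ9.M j (Sect2.domSites (F.P p.K) θ.τ9.M j X) s.Ω)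
    (Γ : ℕ → ℝ)
    (hΓ : ∀ n, 1 ≤ n → n ≤ k →
      ((univ.filter fun c : TPt (F.P p.K).d (Sect2.domCount (F.P p.K) θ.τ9.M n) =>
          (Sect2.domSites (F.P p.K) θ.τ9.M n (Sect2.cubeDom (F.P p.K) θ.τ9.M n c) ∩
              Sect2.enlT (F.P p.K) (Sect2.zSide (F.P p.K) θ.ν θ.τ9.M (gOfRecord₁₃ F N θ.toStage13Params p) n) 1 (s.Λ n)ᶜ).Nonempty ∧
            ∃ c', (c' = c ∨ TAdj c' c) ∧ (Sect2.domSites (F.P p.K) θ.τ9.M n (Sect2.cubeDom (F.P p.K) θ.τ9.M n c') ∩ s.Ω n).Nonempty).card : ℝ) ≤ Γ n) :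
    |B240 (sect2TowerOfRecord F N (FluctV N) p.K (settingOfRecord₁₃ F N θ.toStage13Params p) (θ.rzAt p s) s ((chainWitness θ p σ k).1 s))
        (fun j X => Sect2.admB (F.P p.K) θ.ν θ.τ9.M (gOfRecord₁₃ F N θ.toStage13Params p) s.Ω s.Λ j (Sect2.domSites (F.P p.K) θ.τ9.M j X)) a k U| ≤
      2 * (θ.s2.lf.B₀ * K₀ (4 * 2 ^ (F.P p.K).d) (2 * (F.P p.K).d)) * ∑ n ∈ Icc 1 k, Γ n :=
  h248_of_lawsRT_of_mem_spaceMS θ p s _ a U hk hM hκ hB₀ (lawsRT_chainWitness_of_chainFormAt θ p σ h s) hU Γ hΓ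

/-! ## §3. (2.49) along the chain -/

variable (𝒰 : (k : ℕ) → SeqOfRecord F θ.ν θ.τ9.M (gOfRecord₁₃ F N θ.toStage13Params p) p.K k → Set (GaugeField (F.P p.K) 0 (SU N)))

open Classical in
/-- **★★ (2.49) FOR THE CHAIN's (2.23)-ACTION FROM THEOREM 2 KEYED TO THE CHAIN + THE CHAIN's FORM**: with `B14.Thm2Printed` on the keyed carrier of the chain witness at a
class `𝒰` of (2.41)(ii)-regular configurations (`h𝒰`), `0 < β < 1`, `1 < L`, `κ₀ ≥ 7`, `H033` at the run's flow, couplings `≥ 0`, `κ₀(4·2^d,2d) ≤ θ.s2.lf.κ`, `0 ≤ θ.s2.lf.B₀`,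
`1 ≤ M`: there are `E₁, R₁ ≥ 0` such that at every level `k ≤ K` where `ChainFormAt θ p σ k`, every history `s`, every `U ∈ 𝒰 k s`, all volumes `Γ_n` dominating `|Γ_n(s)|`
and `#ring_n(s)`, (2.46)'s inputs (`Σ_{j≤n} g_j^{κ₀} ≤ g_n^{κ₀−6}`, `R₁ g_n^{κ₀−6} ≤ 1`) and the vacuum sentence give
`Ineq249 (action23 of (s, (chainWitness θ p σ k).1 s, a, E_k) k U) (A(1∕g_k²(·),U)) (−EkLog) (E₁(1−L^{−β})⁻¹ + 1 + 2·θ.s2.lf.B₀·K₀(4·2^d,2d) + E₂) Γ k` — the 𝐁-side binder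
DISCHARGED (§2). [cite: Balaban1988Convergent, Thm 2 p.263, (2.45)–(2.49) pp.263–264, (2.42) p.261] -/
theorem ineq249_action23_chainWitness_of_thm2Printed_keyed (H033 : Flow → ℕ → Prop) {L β : ℝ} {κ₀ : ℕ}
    (hT2 : B14.Thm2Printed H033 (fun _ : PUnit => sect2DataOfRecord₁₃Keyed θ p (fun k s => (chainWitness θ p σ k).1 s) 𝒰) L β κ₀)
    (hβ1 : β < 1) (hβ0 : 0 < β) (hL : 1 < L) (hκ7 : 7 ≤ κ₀)
    (h033 : H033 (flowOfRun (gOfRecord₁₃ F N θ.toStage13Params p)) p.K) (hg : ∀ j, j ≤ p.K → 0 ≤ gOfRecord₁₃ F N θ.toStage13Params p j)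
    (h𝒰 : ∀ k (s : SeqOfRecord F θ.ν θ.τ9.M (gOfRecord₁₃ F N θ.toStage13Params p) p.K k) (U : GaugeField (F.P p.K) 0 (SU N)), U ∈ 𝒰 k s →
      ∀ j, 1 ≤ j → j ≤ k → ∀ X, Sect2.admB (F.P p.K) θ.ν θ.τ9.M (gOfRecord₁₃ F N θ.toStage13Params p) s.Ω s.Λ j (Sect2.domSites (F.P p.K) θ.τ9.M j X) = true →
        Sect2.ofBackgroundC (ιSU N) U ∈ Sect2.spaceMS (settingOfRecord₁₃ F N θ.toStage13Params p) (θ.rzAt p s) θ.τ9.M j (Sect2.domSites (F.P p.K) θ.τ9.M j X) s.Ω)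
    (hκ : kappa₀ (4 * 2 ^ (F.P p.K).d) (2 * (F.P p.K).d) ≤ θ.s2.lf.κ) (hB₀ : 0 ≤ θ.s2.lf.B₀) (hM : 1 ≤ θ.τ9.M) :
    ∃ E₁ R₁ : ℝ, 0 ≤ E₁ ∧ 0 ≤ R₁ ∧
      ∀ k, k ≤ p.K → ChainFormAt θ p σ k → ∀ (s : SeqOfRecord F θ.ν θ.τ9.M (gOfRecord₁₃ F N θ.toStage13Params p) p.K k) (U : GaugeField (F.P p.K) 0 (SU N)), U ∈ 𝒰 k s →
      ∀ (a : Tk.SFluct (F.P p.K) (FluctV N)) (Ek EkLog EkRest : ℝ), Ek = EkLog + EkRest → ∀ (E₂ : ℝ) (Γ : ℕ → ℝ),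
      (∀ n, 1 ≤ n → n ≤ k → ((univ.filter fun y : Site (F.P p.K) n => toFine n y ∈ gammaRegion s.Ω k n).card : ℝ) ≤ Γ n) →
      (∀ n, 1 ≤ n → n ≤ k →
        ((univ.filter fun c : TPt (F.P p.K).d (Sect2.domCount (F.P p.K) θ.τ9.M n) =>
            (Sect2.domSites (F.P p.K) θ.τ9.M n (Sect2.cubeDom (F.P p.K) θ.τ9.M n c) ∩
                Sect2.enlT (F.P p.K) (Sect2.zSide (F.P p.K) θ.ν θ.τ9.M (gOfRecord₁₃ F N θ.toStage13Params p) n) 1 (s.Λ n)ᶜ).Nonempty ∧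
              ∃ c', (c' = c ∨ TAdj c' c) ∧ (Sect2.domSites (F.P p.K) θ.τ9.M n (Sect2.cubeDom (F.P p.K) θ.τ9.M n c') ∩ s.Ω n).Nonempty).card : ℝ) ≤ Γ n) →
      (∀ n, 1 ≤ n → n ≤ k → ∑ j ∈ Icc 1 n, (gOfRecord₁₃ F N θ.toStage13Params p j) ^ κ₀ ≤ (gOfRecord₁₃ F N θ.toStage13Params p n) ^ (κ₀ - 6)) →
      (∀ n, 1 ≤ n → n ≤ k → R₁ * (gOfRecord₁₃ F N θ.toStage13Params p n) ^ (κ₀ - 6) ≤ 1) →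
      VacuumRestBound EkRest E₂ Γ k →
      Ineq249 ((sect2ActionDataOfRecord F N (FluctV N) p.K (settingOfRecord₁₃ F N θ.toStage13Params p) (θ.rzAt p s) s ((chainWitness θ p σ k).1 s) a Ek).action23 k U)
        (smearedWilson (invSq (flowOfRun (gOfRecord₁₃ F N θ.toStage13Params p)) (θ.Phih p k s.Ω s.Λ) k) U) (-EkLog)
        (E₁ * (1 - L ^ (-β))⁻¹ + 1 + 2 * (θ.s2.lf.B₀ * K₀ (4 * 2 ^ (F.P p.K).d) (2 * (F.P p.K).d)) + E₂) Γ k := by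
  obtain ⟨E₁, R₁, hE, hR, hall⟩ :=
    ineq249_action23_of_thm2Printed_keyed θ p (fun k s => (chainWitness θ p σ k).1 s) 𝒰 H033 hT2 hβ1 hβ0 hL hκ7 h033 hg
  refine ⟨E₁, R₁, hE, hR, fun k hk hform s U hU a Ek EkLog EkRest hEk E₂ Γ hΓ hΓr hsum hsmall hvac => ?_⟩
  have hkmK : k ≤ (F.P p.K).m + (F.P p.K).K := by rw [T4Family.P_K]; omega
  exact hall k hk s U hU a Ek EkLog EkRest hEk _ E₂ Γ hΓ hsum hsmall
    (h248_chainWitness_of_chainFormAt θ p σ hform s a U hkmK hM hκ hB₀ (h𝒰 k s U hU) Γ hΓr) hvac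

open Classical in
/-- **★★★ (2.49) ALONG THE WHOLE CHAIN ON THE LIVE-SELECTOR LINE**: the same at EVERY `k ≤ K`, the chain's form supplied by dag-n11-e's Theorem 1 along the chain
(`chainFormAt_all_of_obligations`: `SupplierObligations θ p σ ∧ NoExpansionObligation θ p σ` + def-T's provisos `Provisos₁₃CoPH`, the live selector, `Admissible`, signs of the
constants, `1 ≤ M`) — N11's one-token residual `SupplyChainAt θ p` opened — plus Theorem 2 keyed to the chain. [cite: Balaban1988Convergent, Thm 1 p.262, Thm 2 p.263, (2.49) p.264, §3 p.279] -/
theorem ineq249_action23_chainWitness_of_obligations (hprov : θ.Provisos₁₃CoPH F N)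
    (hsel : θ.ppSel = ppSelLiveOfRecord F N θ.ν θ.τ9 (EOfRecord₁₃ F N θ.toStage13Params) (wOfRecord₉ F N θ.toStage9Params))
    (hθ : θ.Admissible F N) (hE₀ : 0 ≤ θ.s2.lf.E₀) (hB₀ : 0 ≤ θ.s2.lf.B₀) (hM : 1 ≤ θ.τ9.M)
    (hκ : kappa₀ (4 * 2 ^ (F.P p.K).d) (2 * (F.P p.K).d) ≤ θ.s2.lf.κ)
    (hσ : SupplierObligations θ p σ) (hT : NoExpansionObligation θ p σ)
    (H033 : Flow → ℕ → Prop) {L β : ℝ} {κ₀ : ℕ}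
    (hT2 : B14.Thm2Printed H033 (fun _ : PUnit => sect2DataOfRecord₁₃Keyed θ p (fun k s => (chainWitness θ p σ k).1 s) 𝒰) L β κ₀)
    (hβ1 : β < 1) (hβ0 : 0 < β) (hL : 1 < L) (hκ7 : 7 ≤ κ₀)
    (h033 : H033 (flowOfRun (gOfRecord₁₃ F N θ.toStage13Params p)) p.K) (hg : ∀ j, j ≤ p.K → 0 ≤ gOfRecord₁₃ F N θ.toStage13Params p j)
    (h𝒰 : ∀ k (s : SeqOfRecord F θ.ν θ.τ9.M (gOfRecord₁₃ F N θ.toStage13Params p) p.K k) (U : GaugeField (F.P p.K) 0 (SU N)), U ∈ 𝒰 k s →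
      ∀ j, 1 ≤ j → j ≤ k → ∀ X, Sect2.admB (F.P p.K) θ.ν θ.τ9.M (gOfRecord₁₃ F N θ.toStage13Params p) s.Ω s.Λ j (Sect2.domSites (F.P p.K) θ.τ9.M j X) = true →
        Sect2.ofBackgroundC (ιSU N) U ∈ Sect2.spaceMS (settingOfRecord₁₃ F N θ.toStage13Params p) (θ.rzAt p s) θ.τ9.M j (Sect2.domSites (F.P p.K) θ.τ9.M j X) s.Ω) :
    ∃ E₁ R₁ : ℝ, 0 ≤ E₁ ∧ 0 ≤ R₁ ∧
      ∀ k, k ≤ p.K → ∀ (s : SeqOfRecord F θ.ν θ.τ9.M (gOfRecord₁₃ F N θ.toStage13Params p) p.K k) (U : GaugeField (F.P p.K) 0 (SU N)), U ∈ 𝒰 k s →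
      ∀ (a : Tk.SFluct (F.P p.K) (FluctV N)) (Ek EkLog EkRest : ℝ), Ek = EkLog + EkRest → ∀ (E₂ : ℝ) (Γ : ℕ → ℝ),
      (∀ n, 1 ≤ n → n ≤ k → ((univ.filter fun y : Site (F.P p.K) n => toFine n y ∈ gammaRegion s.Ω k n).card : ℝ) ≤ Γ n) →
      (∀ n, 1 ≤ n → n ≤ k →
        ((univ.filter fun c : TPt (F.P p.K).d (Sect2.domCount (F.P p.K) θ.τ9.M n) =>
            (Sect2.domSites (F.P p.K) θ.τ9.M n (Sect2.cubeDom (F.P p.K) θ.τ9.M n c) ∩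
                Sect2.enlT (F.P p.K) (Sect2.zSide (F.P p.K) θ.ν θ.τ9.M (gOfRecord₁₃ F N θ.toStage13Params p) n) 1 (s.Λ n)ᶜ).Nonempty ∧
              ∃ c', (c' = c ∨ TAdj c' c) ∧ (Sect2.domSites (F.P p.K) θ.τ9.M n (Sect2.cubeDom (F.P p.K) θ.τ9.M n c') ∩ s.Ω n).Nonempty).card : ℝ) ≤ Γ n) →
      (∀ n, 1 ≤ n → n ≤ k → ∑ j ∈ Icc 1 n, (gOfRecord₁₃ F N θ.toStage13Params p j) ^ κ₀ ≤ (gOfRecord₁₃ F N θ.toStage13Params p n) ^ (κ₀ - 6)) →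
      (∀ n, 1 ≤ n → n ≤ k → R₁ * (gOfRecord₁₃ F N θ.toStage13Params p n) ^ (κ₀ - 6) ≤ 1) →
      VacuumRestBound EkRest E₂ Γ k →
      Ineq249 ((sect2ActionDataOfRecord F N (FluctV N) p.K (settingOfRecord₁₃ F N θ.toStage13Params p) (θ.rzAt p s) s ((chainWitness θ p σ k).1 s) a Ek).action23 k U)
        (smearedWilson (invSq (flowOfRun (gOfRecord₁₃ F N θ.toStage13Params p)) (θ.Phih p k s.Ω s.Λ) k) U) (-EkLog)
        (E₁ * (1 - L ^ (-β))⁻¹ + 1 + 2 * (θ.s2.lf.B₀ * K₀ (4 * 2 ^ (F.P p.K).d) (2 * (F.P p.K).d)) + E₂) Γ k := by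
  have hκ0 : 0 ≤ θ.s2.lf.κ := (kappa₀_nonneg (by positivity) _).trans hκ
  obtain ⟨E₁, R₁, hE, hR, hall⟩ :=
    ineq249_action23_chainWitness_of_thm2Printed_keyed θ p σ 𝒰 H033 hT2 hβ1 hβ0 hL hκ7 h033 hg h𝒰 hκ hB₀ hM
  exact ⟨E₁, R₁, hE, hR, fun k hk => hall k hk (chainFormAt_all_of_obligations hprov hsel hθ hκ0 hE₀ hB₀ hM σ hσ hT k hk)⟩

/-! ## §4. A6: the class hypotheses are jointly inhabited by the unit class -/

/-- **The unit configuration lies in `Ũ^c_j(X)` of record at every history** (dag-n11-e's `Sect2.one_mem_spaceMS_of_le` at the record's setting and the history's residual; positive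
radii `α_{0,n}, α_{1,n}`, `1 ≤ n ≤ j`, displayed; `θ.s2.Pos` and the residual laws from def-T's provisos). [cite: Balaban1988Convergent, (2.34)–(2.39) p.261] -/
theorem one_mem_spaceMS_rzAt (hprov : θ.Provisos₁₃CoPH F N) (hpos : θ.s2.Pos) {k : ℕ}
    (s : SeqOfRecord F θ.ν θ.τ9.M (gOfRecord₁₃ F N θ.toStage13Params p) p.K k) {j : ℕ}
    (hα : ∀ n, 1 ≤ n → n ≤ j → 0 < (settingOfRecord₁₃ F N θ.toStage13Params p).lf.alpha0 (gOfRecord₁₃ F N θ.toStage13Params p n) ∧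
      0 < (settingOfRecord₁₃ F N θ.toStage13Params p).lf.alpha1 (gOfRecord₁₃ F N θ.toStage13Params p n))
    (Y : Set (Site (F.P p.K) 0)) :
    Sect2.ofBackgroundC (ιSU N) (1 : GaugeField (F.P p.K) 0 (SU N)) ∈ Sect2.spaceMS (settingOfRecord₁₃ F N θ.toStage13Params p) (θ.rzAt p s) θ.τ9.M j Y s.Ω :=
  Sect2.one_mem_spaceMS_of_le (settingOfRecord₁₃ F N θ.toStage13Params p) (settingOfRecord₁₃_pos F N θ.toStage13Params hpos p) (hprov.rzAtLaws p s)
    θ.τ9.M j Y s.Ω hα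

/-- **★ A6 — THE UNIT CLASS `𝒰 ≡ {1}` MEETS THE REGULARITY HYPOTHESIS `h𝒰` OF §3** (given positive radii at every level `n ≥ 1`); together with g2 FILE C's
`thm2Printed_keyed_unitClass` (Theorem 2 keyed holds at the unit class with `E₁ = R₁ = 0`) the class hypotheses of `ineq249_action23_chainWitness_of_thm2Printed_keyed ∕ _of_obligations`
are JOINTLY INHABITED — the conclusions are not vacuous by contradiction in them; the obligations `(hσ, hT)` stay displayed (dag-n11-e's `…Sect3SupplyChainZero` inhabits them in the
all-absent runs). [cite: Balaban1988Convergent, (2.34)–(2.39) p.261, Thm 2 p.263 (bookkeeping)] -/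
theorem unitClass_regular (hprov : θ.Provisos₁₃CoPH F N) (hpos : θ.s2.Pos)
    (hα : ∀ n, 1 ≤ n → 0 < (settingOfRecord₁₃ F N θ.toStage13Params p).lf.alpha0 (gOfRecord₁₃ F N θ.toStage13Params p n) ∧
      0 < (settingOfRecord₁₃ F N θ.toStage13Params p).lf.alpha1 (gOfRecord₁₃ F N θ.toStage13Params p n)) :
    ∀ k (s : SeqOfRecord F θ.ν θ.τ9.M (gOfRecord₁₃ F N θ.toStage13Params p) p.K k) (U : GaugeField (F.P p.K) 0 (SU N)),
      U ∈ (fun (_ : ℕ) (_ : SeqOfRecord F θ.ν θ.τ9.M (gOfRecord₁₃ F N θ.toStage13Params p) p.K k) => ({1} : Set (GaugeField (F.P p.K) 0 (SU N)))) k s →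
      ∀ j, 1 ≤ j → j ≤ k → ∀ X, Sect2.admB (F.P p.K) θ.ν θ.τ9.M (gOfRecord₁₃ F N θ.toStage13Params p) s.Ω s.Λ j (Sect2.domSites (F.P p.K) θ.τ9.M j X) = true →
        Sect2.ofBackgroundC (ιSU N) U ∈ Sect2.spaceMS (settingOfRecord₁₃ F N θ.toStage13Params p) (θ.rzAt p s) θ.τ9.M j (Sect2.domSites (F.P p.K) θ.τ9.M j X) s.Ω := by
  intro k s U hU j _ _ X _
  have hU1 : U = 1 := hU
  rw [hU1]
  exact one_mem_spaceMS_rzAt θ p hprov hpos s (fun n h1 _ => hα n h1) _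

end Summit.QuantumFields.YangMills.Theorems.BalabanUVNodesN11Thm2AlongSupplyChain

end
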